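import Literature.MathematicalPhysics.KineticTheory.TransportDuhamel
import Literature.MathematicalPhysics.KineticTheory.TruncatedCollisionDerivatives
import Literature.Analysis.FunctionSpaces.IteratedFDerivParametricIntegral
import HarnessLib

/-!
# Qualitative space-time regularity of the Duhamel formula

Topic: MathematicalPhysics / KineticTheory. Continuation of `TransportDuhamel`. The Duhamel
solution `U` of `∂ₜU + v·∇ₓU = Γ - ΛU` inherits from `Λ`, `Γ` (smooth, all space-time
derivatives bounded with polynomial weights in `(x,v)` on every time slab `|t| ≤ T'`) and from
Schwartz-type data `f₀` the same weighted bounds of *all total derivatives* (`duhamel_decST`).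
This qualitative statement (constants may depend on everything) is what makes the velocity
moments of the iterates of the DiPerna–Lions scheme smooth in `(t, x)` (the dominated
differentiation of `∫ f dv` needs decay of total derivatives). The uniform-in-the-iteration
bounds are the business of `TransportDuhamelDerivatives`.

Method: after the substitutions `σ = t θ' θ`, `s = t θ'` the formula reads
`U(p) = Ũ((0,0), p)` where `Ũ(θ, θ'; p)` is assembled from `Λ ∘ Ψ`, `Γ ∘ Ψ`, `f₀ ∘ Ψ` with the
polynomial map `Ψ(θ,θ'; t,x,v) = (tθ'θ, x - (t - tθ'θ)v, v)` by products, `e^{-(·)}`,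
multiplication by `t` and `tθ'`, affine reparametrisations of `(θ, θ')`, and `∫₀¹ dθ`; the
weighted class (written out as a hypothesis shape, "`Dec2`") is closed under these operations.

* Generic: `norm_iteratedFDeriv_clm_le`, `norm_iteratedFDeriv_clm_comp_le`,
  `opNorm_comp_le_one`, `norm_iteratedFDeriv_mul_le_two_pow`, `norm_iteratedFDeriv_smul_le_two_pow`,
  `norm_iteratedFDeriv_coord_le`.
* `psi_coords`, `psi_scalar_bounds`, `psi_space_bounds`, `norm_iteratedFDeriv_psi_le`
  (`‖D^i Ψ‖ ≤ 6·8^i (1+T')(1+‖(x,v)‖)`).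
* Closure: `bdd2_of_dec2`, `dec2_mul`, `bdd2_comp_scalar`, `norm_iteratedFDeriv_comp_affine_le`,
  `dec2_comp_affine`, `exists_sliceCLM`, `dec2_intervalIntegral`, `dec2_comp_psi`, `dec2_add`,
  `dec2_sub`, `bdd2_coords`, `decST_of_data`, `exists_paramCLMs`.
* `duhamel_decST` — the result.

Everything is proved; theorems only.

## References

* C. Cercignani, R. Illner, M. Pulvirenti, *The Mathematical Theory of Dilute Gases*, Springer
  (1994), §5.3, Lemma 5.3.6 (regularity of the truncated problems), pp. 145–146.
-/

noncomputable section

open MeasureTheory Set Filter Topology Metric intervalIntegral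
open scoped ContDiff

namespace Literature.MathematicalPhysics.KineticTheory

open Literature.Analysis.FunctionSpaces

/-! ## Generic derivative bookkeeping -/

section Generic

variable {Q : Type*} [NormedAddCommGroup Q] [NormedSpace ℝ Q]
variable {F' : Type*} [NormedAddCommGroup F'] [NormedSpace ℝ F']
variable {G' : Type*} [NormedAddCommGroup G'] [NormedSpace ℝ G']

/-- Derivatives of order `≥ 1` of a continuous linear map have norm `≤ ‖L‖`. [folklore] -/
theorem norm_iteratedFDeriv_clm_le (L : Q →L[ℝ] F') {i : ℕ} (hi : 1 ≤ i) (q : Q) :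
    ‖iteratedFDeriv ℝ i (L : Q → F') q‖ ≤ ‖L‖ := by
  obtain ⟨j, rfl⟩ : ∃ j, i = j + 1 := ⟨i - 1, by omega⟩
  rw [← norm_iteratedFDeriv_fderiv]
  have hfd : fderiv ℝ (L : Q → F') = fun _ => L := by funext q; exact L.fderiv
  rw [hfd]
  rcases j with _ | j
  · rw [norm_iteratedFDeriv_zero]
  · rw [iteratedFDeriv_succ_const]; simp

/-- Post-composition with a continuous linear map costs at most its norm. [folklore] -/
theorem norm_iteratedFDeriv_clm_comp_le (g : F' →L[ℝ] G') {f : Q → F'} (hf : ContDiff ℝ ∞ f) (i : ℕ) (q : Q) :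
    ‖iteratedFDeriv ℝ i (fun q => g (f q)) q‖ ≤ ‖g‖ * ‖iteratedFDeriv ℝ i f q‖ := by
  have h := g.iteratedFDeriv_comp_left (f := f) (x := q) (hf.contDiffAt) (i := i) (by exact_mod_cast le_top)
  change ‖iteratedFDeriv ℝ i (g ∘ f) q‖ ≤ _
  rw [h]
  exact g.norm_compContinuousMultilinearMap_le _

/-- Composition of continuous linear maps of norm `≤ 1` has norm `≤ 1`. [folklore] -/
theorem opNorm_comp_le_one {Y : Type*} [NormedAddCommGroup Y] [NormedSpace ℝ Y]
    (f : Y →L[ℝ] G') (g : Q →L[ℝ] Y) (hf : ‖f‖ ≤ 1) (hg : ‖g‖ ≤ 1) : ‖f.comp g‖ ≤ 1 :=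
  (ContinuousLinearMap.opNorm_comp_le f g).trans (by nlinarith [norm_nonneg f, norm_nonneg g])

/-- Leibniz with uniform bounds: `‖D^n (a b)‖ ≤ 2^n A B`. [folklore] -/
theorem norm_iteratedFDeriv_mul_le_two_pow {a b : Q → ℝ} (ha : ContDiff ℝ ∞ a) (hb : ContDiff ℝ ∞ b)
    {n : ℕ} {q : Q} {A B : ℝ} (hA : ∀ i, i ≤ n → ‖iteratedFDeriv ℝ i a q‖ ≤ A)
    (hB : ∀ i, i ≤ n → ‖iteratedFDeriv ℝ i b q‖ ≤ B) :
    ‖iteratedFDeriv ℝ n (fun q => a q * b q) q‖ ≤ 2 ^ n * A * B := by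
  have hA0 : 0 ≤ A := (norm_nonneg _).trans (hA 0 (Nat.zero_le _))
  have hB0 : 0 ≤ B := (norm_nonneg _).trans (hB 0 (Nat.zero_le _))
  refine (norm_iteratedFDeriv_mul_le (n := n) ha hb q (by exact_mod_cast le_top)).trans ?_
  calc ∑ i ∈ Finset.range (n + 1), (n.choose i : ℝ) * ‖iteratedFDeriv ℝ i a q‖ * ‖iteratedFDeriv ℝ (n - i) b q‖
      ≤ ∑ i ∈ Finset.range (n + 1), (n.choose i : ℝ) * A * B := Finset.sum_le_sum fun i hi => by
        rw [Finset.mem_range] at hi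
        exact mul_le_mul (mul_le_mul_of_nonneg_left (hA i (by omega)) (by positivity)) (hB (n - i) (by omega))
          (norm_nonneg _) (by positivity)
    _ = 2 ^ n * A * B := by
        rw [← Finset.sum_mul, ← Finset.sum_mul]
        congr 1; congr 1
        have h := Nat.sum_range_choose n
        exact_mod_cast h

/-- Leibniz for scalar multiplication with uniform bounds: `‖D^n (a • w)‖ ≤ 2^n A B`. [folklore] -/
theorem norm_iteratedFDeriv_smul_le_two_pow {a : Q → ℝ} {w : Q → F'} (ha : ContDiff ℝ ∞ a) (hw : ContDiff ℝ ∞ w)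
    {n : ℕ} {q : Q} {A B : ℝ} (hA : ∀ i, i ≤ n → ‖iteratedFDeriv ℝ i a q‖ ≤ A)
    (hB : ∀ i, i ≤ n → ‖iteratedFDeriv ℝ i w q‖ ≤ B) :
    ‖iteratedFDeriv ℝ n (fun q => a q • w q) q‖ ≤ 2 ^ n * A * B := by
  have hA0 : 0 ≤ A := (norm_nonneg _).trans (hA 0 (Nat.zero_le _))
  have hB0 : 0 ≤ B := (norm_nonneg _).trans (hB 0 (Nat.zero_le _))
  refine (norm_iteratedFDeriv_smul_le (n := n) ha hw q (by exact_mod_cast le_top)).trans ?_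
  calc ∑ i ∈ Finset.range (n + 1), (n.choose i : ℝ) * ‖iteratedFDeriv ℝ i a q‖ * ‖iteratedFDeriv ℝ (n - i) w q‖
      ≤ ∑ i ∈ Finset.range (n + 1), (n.choose i : ℝ) * A * B := Finset.sum_le_sum fun i hi => by
        rw [Finset.mem_range] at hi
        exact mul_le_mul (mul_le_mul_of_nonneg_left (hA i (by omega)) (by positivity)) (hB (n - i) (by omega))
          (norm_nonneg _) (by positivity)
    _ = 2 ^ n * A * B := by
        rw [← Finset.sum_mul, ← Finset.sum_mul]
        congr 1; congr 1
        have h := Nat.sum_range_choose n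
        exact_mod_cast h

/-- Derivatives of all orders of a coordinate-like map: values bounded by `V` in norm, the map
linear of norm `≤ 1`; then `‖D^i L q‖ ≤ max V 1` for all `i`. [folklore] -/
theorem norm_iteratedFDeriv_coord_le (L : Q →L[ℝ] F') (hL : ‖L‖ ≤ 1) {q : Q} {V : ℝ} (hV : ‖L q‖ ≤ V) (i : ℕ) :
    ‖iteratedFDeriv ℝ i (L : Q → F') q‖ ≤ max V 1 := by
  rcases Nat.eq_zero_or_pos i with rfl | hi
  · rw [norm_iteratedFDeriv_zero]; exact hV.trans (le_max_left _ _)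
  · exact (norm_iteratedFDeriv_clm_le L hi q).trans (hL.trans (le_max_right _ _))

end Generic

variable {E : Type*} [NormedAddCommGroup E] [NormedSpace ℝ E]

/-! ## The substitution map `Ψ(θ, θ'; t, x, v) = (tθ'θ, x - (t - tθ'θ)v, v)` -/

section Psi

/-- The coordinate projections of `(ℝ × ℝ) × (ℝ × E × E)` as continuous linear maps of norm
`≤ 1`. [folklore] -/
theorem psi_coords :
    ∃ (Lθ Lθ' Lt : (ℝ × ℝ) × (ℝ × E × E) →L[ℝ] ℝ) (Lx Lv : (ℝ × ℝ) × (ℝ × E × E) →L[ℝ] E),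
      (∀ q, Lθ q = q.1.1) ∧ (∀ q, Lθ' q = q.1.2) ∧ (∀ q, Lt q = q.2.1) ∧ (∀ q, Lx q = q.2.2.1) ∧
      (∀ q, Lv q = q.2.2.2) ∧ ‖Lθ‖ ≤ 1 ∧ ‖Lθ'‖ ≤ 1 ∧ ‖Lt‖ ≤ 1 ∧ ‖Lx‖ ≤ 1 ∧ ‖Lv‖ ≤ 1 := by
  refine ⟨(ContinuousLinearMap.fst ℝ ℝ ℝ).comp (ContinuousLinearMap.fst ℝ (ℝ × ℝ) (ℝ × E × E)),
    (ContinuousLinearMap.snd ℝ ℝ ℝ).comp (ContinuousLinearMap.fst ℝ (ℝ × ℝ) (ℝ × E × E)),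
    (ContinuousLinearMap.fst ℝ ℝ (E × E)).comp (ContinuousLinearMap.snd ℝ (ℝ × ℝ) (ℝ × E × E)),
    (ContinuousLinearMap.fst ℝ E E).comp ((ContinuousLinearMap.snd ℝ ℝ (E × E)).comp (ContinuousLinearMap.snd ℝ (ℝ × ℝ) (ℝ × E × E))),
    (ContinuousLinearMap.snd ℝ E E).comp ((ContinuousLinearMap.snd ℝ ℝ (E × E)).comp (ContinuousLinearMap.snd ℝ (ℝ × ℝ) (ℝ × E × E))),
    fun q => rfl, fun q => rfl, fun q => rfl, fun q => rfl, fun q => rfl, ?_, ?_, ?_, ?_, ?_⟩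
  · exact opNorm_comp_le_one _ _ (ContinuousLinearMap.norm_fst_le ℝ ℝ ℝ) (ContinuousLinearMap.norm_fst_le ℝ (ℝ × ℝ) (ℝ × E × E))
  · exact opNorm_comp_le_one _ _ (ContinuousLinearMap.norm_snd_le ℝ ℝ ℝ) (ContinuousLinearMap.norm_fst_le ℝ (ℝ × ℝ) (ℝ × E × E))
  · exact opNorm_comp_le_one _ _ (ContinuousLinearMap.norm_fst_le ℝ ℝ (E × E)) (ContinuousLinearMap.norm_snd_le ℝ (ℝ × ℝ) (ℝ × E × E))
  · exact opNorm_comp_le_one _ _ (ContinuousLinearMap.norm_fst_le ℝ E E)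
      (opNorm_comp_le_one _ _ (ContinuousLinearMap.norm_snd_le ℝ ℝ (E × E)) (ContinuousLinearMap.norm_snd_le ℝ (ℝ × ℝ) (ℝ × E × E)))
  · exact opNorm_comp_le_one _ _ (ContinuousLinearMap.norm_snd_le ℝ E E)
      (opNorm_comp_le_one _ _ (ContinuousLinearMap.norm_snd_le ℝ ℝ (E × E)) (ContinuousLinearMap.norm_snd_le ℝ (ℝ × ℝ) (ℝ × E × E)))

/-- Derivative bounds for the scalar parts `t θ' θ` and `t - t θ' θ` of `Ψ`. [folklore] -/
theorem psi_scalar_bounds {T' : ℝ} (hT' : 0 ≤ T')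
    (q : (ℝ × ℝ) × (ℝ × E × E)) (hq : q.1 ∈ Icc (0 : ℝ) 1 ×ˢ Icc (0 : ℝ) 1) (ht : |q.2.1| ≤ T') (j : ℕ) :
    ‖iteratedFDeriv ℝ j (fun q : (ℝ × ℝ) × (ℝ × E × E) => q.2.1 * q.1.2 * q.1.1) q‖ ≤ 4 ^ j * (1 + T') ∧
    ‖iteratedFDeriv ℝ j (fun q : (ℝ × ℝ) × (ℝ × E × E) => q.2.1 - q.2.1 * q.1.2 * q.1.1) q‖ ≤ 2 * 4 ^ j * (1 + T') := by
  obtain ⟨Lθ, Lθ', Lt, Lx, Lv, hθ, hθ', hLt, hLx, hLv, nθ, nθ', nt, nx, nv⟩ := psi_coords (E := E)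
  obtain ⟨⟨hθ0, hθ1⟩, ⟨hθ'0, hθ'1⟩⟩ := hq
  have vθ : ‖Lθ q‖ ≤ 1 := by rw [hθ, Real.norm_eq_abs, abs_le]; exact ⟨by linarith, hθ1⟩
  have vθ' : ‖Lθ' q‖ ≤ 1 := by rw [hθ', Real.norm_eq_abs, abs_le]; exact ⟨by linarith, hθ'1⟩
  have vt : ‖Lt q‖ ≤ T' := by rw [hLt, Real.norm_eq_abs]; exact ht
  have dθ : ∀ i, ‖iteratedFDeriv ℝ i (Lθ : _ → ℝ) q‖ ≤ 1 := fun i => by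
    simpa using norm_iteratedFDeriv_coord_le Lθ nθ vθ i
  have dθ' : ∀ i, ‖iteratedFDeriv ℝ i (Lθ' : _ → ℝ) q‖ ≤ 1 := fun i => by
    simpa using norm_iteratedFDeriv_coord_le Lθ' nθ' vθ' i
  have dt : ∀ i, ‖iteratedFDeriv ℝ i (Lt : _ → ℝ) q‖ ≤ 1 + T' := fun i =>
    (norm_iteratedFDeriv_coord_le Lt nt vt i).trans (max_le (by linarith) (by linarith))
  have hf1 : (fun q : (ℝ × ℝ) × (ℝ × E × E) => q.2.1 * q.1.2) = fun q => Lt q * Lθ' q := by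
    funext q; rw [hLt, hθ']
  have hfa : (fun q : (ℝ × ℝ) × (ℝ × E × E) => q.2.1 * q.1.2 * q.1.1) = fun q => (Lt q * Lθ' q) * Lθ q := by
    funext q; rw [hLt, hθ', hθ]
  have h1s : ContDiff ℝ ∞ fun q => Lt q * Lθ' q := Lt.contDiff.mul Lθ'.contDiff
  have has : ContDiff ℝ ∞ fun q => (Lt q * Lθ' q) * Lθ q := h1s.mul Lθ.contDiff
  have da1 : ∀ i, ‖iteratedFDeriv ℝ i (fun q => Lt q * Lθ' q) q‖ ≤ 2 ^ i * (1 + T') := fun i => by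
    have h := norm_iteratedFDeriv_mul_le_two_pow (n := i) (q := q) Lt.contDiff Lθ'.contDiff (fun i _ => dt i) (fun i _ => dθ' i)
    simpa using h
  have da : ∀ i, ‖iteratedFDeriv ℝ i (fun q => (Lt q * Lθ' q) * Lθ q) q‖ ≤ 4 ^ i * (1 + T') := fun i => by
    have h := norm_iteratedFDeriv_mul_le_two_pow (n := i) (q := q) h1s Lθ.contDiff (A := 2 ^ i * (1 + T')) (B := 1)
      (fun i' hi => (da1 i').trans (mul_le_mul_of_nonneg_right (pow_le_pow_right₀ (by norm_num) hi) (by linarith)))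
      (fun i _ => dθ i)
    calc ‖iteratedFDeriv ℝ i (fun q => (Lt q * Lθ' q) * Lθ q) q‖ ≤ 2 ^ i * (2 ^ i * (1 + T')) * 1 := h
      _ = 4 ^ i * (1 + T') := by rw [mul_one, ← mul_assoc, ← mul_pow]; norm_num
  refine ⟨by rw [hfa]; exact da j, ?_⟩
  have hfs : (fun q : (ℝ × ℝ) × (ℝ × E × E) => q.2.1 - q.2.1 * q.1.2 * q.1.1) =
      (Lt : _ → ℝ) - fun q => (Lt q * Lθ' q) * Lθ q := by
    funext q; simp only [Pi.sub_apply, hLt, hθ', hθ]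
  rw [hfs, iteratedFDeriv_sub_apply (f := (Lt : _ → ℝ)) (g := fun q => (Lt q * Lθ' q) * Lθ q)
    (Lt.contDiff.of_le (by exact_mod_cast le_top)).contDiffAt (has.of_le (by exact_mod_cast le_top)).contDiffAt]
  refine (norm_sub_le _ _).trans ?_
  have h4 : (1 : ℝ) ≤ 4 ^ j := one_le_pow₀ (by norm_num)
  have := dt j
  have := da j
  nlinarith

/-- Derivative bounds for the spatial part `x - (t - tθ'θ) • v` of `Ψ`. [folklore] -/
theorem psi_space_bounds {T' : ℝ} (hT' : 0 ≤ T')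
    (q : (ℝ × ℝ) × (ℝ × E × E)) (hq : q.1 ∈ Icc (0 : ℝ) 1 ×ˢ Icc (0 : ℝ) 1) (ht : |q.2.1| ≤ T') (j : ℕ) :
    ‖iteratedFDeriv ℝ j (fun q : (ℝ × ℝ) × (ℝ × E × E) =>
        q.2.2.1 - (q.2.1 - q.2.1 * q.1.2 * q.1.1) • q.2.2.2) q‖ ≤ 3 * 8 ^ j * (1 + T') * (1 + ‖q.2.2‖) ∧
    ‖iteratedFDeriv ℝ j (fun q : (ℝ × ℝ) × (ℝ × E × E) => q.2.2.2) q‖ ≤ 1 + ‖q.2.2‖ := by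
  obtain ⟨Lθ, Lθ', Lt, Lx, Lv, hθ, hθ', hLt, hLx, hLv, nθ, nθ', nt, nx, nv⟩ := psi_coords (E := E)
  set Z : ℝ := ‖q.2.2‖ with hZ
  have hZ0 : 0 ≤ Z := norm_nonneg _
  have vx : ‖Lx q‖ ≤ Z := by rw [hLx]; exact norm_fst_le q.2.2
  have vv : ‖Lv q‖ ≤ Z := by rw [hLv]; exact norm_snd_le q.2.2
  have dx : ∀ i, ‖iteratedFDeriv ℝ i (Lx : _ → E) q‖ ≤ 1 + Z := fun i =>
    (norm_iteratedFDeriv_coord_le Lx nx vx i).trans (max_le (by linarith) (by linarith))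
  have dv : ∀ i, ‖iteratedFDeriv ℝ i (Lv : _ → E) q‖ ≤ 1 + Z := fun i =>
    (norm_iteratedFDeriv_coord_le Lv nv vv i).trans (max_le (by linarith) (by linarith))
  have hvf : (fun q : (ℝ × ℝ) × (ℝ × E × E) => q.2.2.2) = (Lv : _ → E) := by funext q; rw [hLv]
  refine ⟨?_, by rw [hvf]; exact dv j⟩
  set sfun : (ℝ × ℝ) × (ℝ × E × E) → ℝ := fun q => q.2.1 - q.2.1 * q.1.2 * q.1.1 with hs
  have hss : ContDiff ℝ ∞ sfun :=
    (contDiff_fst.comp contDiff_snd).sub (((contDiff_fst.comp contDiff_snd).mul (contDiff_snd.comp contDiff_fst)).mul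
      (contDiff_fst.comp contDiff_fst))
  have ds : ∀ i, ‖iteratedFDeriv ℝ i sfun q‖ ≤ 2 * 4 ^ i * (1 + T') := fun i => (psi_scalar_bounds hT' q hq ht i).2
  have hsv : ContDiff ℝ ∞ fun q => sfun q • Lv q := hss.smul Lv.contDiff
  have dsv : ‖iteratedFDeriv ℝ j (fun q => sfun q • Lv q) q‖ ≤ 2 * 8 ^ j * (1 + T') * (1 + Z) := by
    have h := norm_iteratedFDeriv_smul_le_two_pow (n := j) (q := q) hss Lv.contDiff (A := 2 * 4 ^ j * (1 + T')) (B := 1 + Z)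
      (fun i hi => (ds i).trans (by
        have := pow_le_pow_right₀ (by norm_num : (1 : ℝ) ≤ 4) hi
        nlinarith))
      (fun i _ => dv i)
    calc ‖iteratedFDeriv ℝ j (fun q => sfun q • Lv q) q‖ ≤ 2 ^ j * (2 * 4 ^ j * (1 + T')) * (1 + Z) := h
      _ = 2 * 8 ^ j * (1 + T') * (1 + Z) := by
          have : (8 : ℝ) ^ j = 2 ^ j * 4 ^ j := by rw [← mul_pow]; norm_num
          rw [this]; ring
  have hbf : (fun q : (ℝ × ℝ) × (ℝ × E × E) => q.2.2.1 - (q.2.1 - q.2.1 * q.1.2 * q.1.1) • q.2.2.2) =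
      (Lx : _ → E) - fun q => sfun q • Lv q := by
    funext q; simp only [Pi.sub_apply, hLx, hLv, hs]
  rw [hbf, iteratedFDeriv_sub_apply (f := (Lx : _ → E)) (g := fun q => sfun q • Lv q)
    (Lx.contDiff.of_le (by exact_mod_cast le_top)).contDiffAt (hsv.of_le (by exact_mod_cast le_top)).contDiffAt]
  refine (norm_sub_le _ _).trans ?_
  have h8 : (1 : ℝ) ≤ 8 ^ j := one_le_pow₀ (by norm_num)
  have hk : (1 + Z) ≤ 8 ^ j * (1 + T') * (1 + Z) :=
    le_mul_of_one_le_left (by positivity) (by nlinarith)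
  linarith [dx j, dsv]

/-- **Derivative bounds for the substitution map** `Ψ q = (t θ' θ, x - (t - t θ' θ) • v, v)` on
`(ℝ × ℝ) × (ℝ × E × E)`: for `θ, θ' ∈ [0,1]`, `|t| ≤ T'` and every order `i`,
`‖D^i Ψ(q)‖ ≤ 6 · 8^i (1 + T') (1 + ‖(x, v)‖)`. [folklore] -/
theorem norm_iteratedFDeriv_psi_le {T' : ℝ} (hT' : 0 ≤ T')
    (q : (ℝ × ℝ) × (ℝ × E × E)) (hq : q.1 ∈ Icc (0 : ℝ) 1 ×ˢ Icc (0 : ℝ) 1) (ht : |q.2.1| ≤ T') (i : ℕ) :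
    ‖iteratedFDeriv ℝ i (fun q : (ℝ × ℝ) × (ℝ × E × E) =>
        (q.2.1 * q.1.2 * q.1.1, q.2.2.1 - (q.2.1 - q.2.1 * q.1.2 * q.1.1) • q.2.2.2, q.2.2.2)) q‖ ≤
      6 * 8 ^ i * (1 + T') * (1 + ‖q.2.2‖) := by
  set Z : ℝ := ‖q.2.2‖ with hZ
  have hZ0 : 0 ≤ Z := norm_nonneg _
  set a : (ℝ × ℝ) × (ℝ × E × E) → ℝ := fun q => q.2.1 * q.1.2 * q.1.1 with ha
  set b : (ℝ × ℝ) × (ℝ × E × E) → E := fun q => q.2.2.1 - (q.2.1 - q.2.1 * q.1.2 * q.1.1) • q.2.2.2 with hb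
  set c : (ℝ × ℝ) × (ℝ × E × E) → E := fun q => q.2.2.2 with hc
  have has : ContDiff ℝ ∞ a := ((contDiff_fst.comp contDiff_snd).mul (contDiff_snd.comp contDiff_fst)).mul
    (contDiff_fst.comp contDiff_fst)
  have hcs : ContDiff ℝ ∞ c := contDiff_snd.comp (contDiff_snd.comp contDiff_snd)
  have hbs : ContDiff ℝ ∞ b := (contDiff_fst.comp (contDiff_snd.comp contDiff_snd)).sub
    (((contDiff_fst.comp contDiff_snd).sub has).smul hcs)
  have da : ‖iteratedFDeriv ℝ i a q‖ ≤ 4 ^ i * (1 + T') := (psi_scalar_bounds hT' q hq ht i).1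
  obtain ⟨db, dc⟩ := psi_space_bounds hT' q hq ht i
  -- the map as a sum of embedded blocks
  obtain ⟨e₁, he₁⟩ : ∃ e₁ : ℝ →L[ℝ] ℝ × E × E, e₁ = ContinuousLinearMap.inl ℝ ℝ (E × E) := ⟨_, rfl⟩
  obtain ⟨e₂, he₂⟩ : ∃ e₂ : E →L[ℝ] ℝ × E × E,
    e₂ = (ContinuousLinearMap.inr ℝ ℝ (E × E)).comp (ContinuousLinearMap.inl ℝ E E) := ⟨_, rfl⟩
  obtain ⟨e₃, he₃⟩ : ∃ e₃ : E →L[ℝ] ℝ × E × E,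
    e₃ = (ContinuousLinearMap.inr ℝ ℝ (E × E)).comp (ContinuousLinearMap.inr ℝ E E) := ⟨_, rfl⟩
  have hne₁ : ‖e₁‖ ≤ 1 := by rw [he₁]; exact ContinuousLinearMap.norm_inl_le_one ℝ ℝ (E × E)
  have hne₂ : ‖e₂‖ ≤ 1 := by
    rw [he₂]
    exact opNorm_comp_le_one _ _ (ContinuousLinearMap.norm_inr_le_one ℝ ℝ (E × E)) (ContinuousLinearMap.norm_inl_le_one ℝ E E)
  have hne₃ : ‖e₃‖ ≤ 1 := by
    rw [he₃]
    exact opNorm_comp_le_one _ _ (ContinuousLinearMap.norm_inr_le_one ℝ ℝ (E × E)) (ContinuousLinearMap.norm_inr_le_one ℝ E E)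
  have hΨeq : (fun q : (ℝ × ℝ) × (ℝ × E × E) =>
      (q.2.1 * q.1.2 * q.1.1, q.2.2.1 - (q.2.1 - q.2.1 * q.1.2 * q.1.1) • q.2.2.2, q.2.2.2)) =
      (fun q => e₁ (a q)) + ((fun q => e₂ (b q)) + fun q => e₃ (c q)) := by
    funext q
    simp only [he₁, he₂, he₃, ha, hb, hc, Pi.add_apply, ContinuousLinearMap.inl_apply,
      ContinuousLinearMap.coe_comp, Function.comp_apply, ContinuousLinearMap.inr_apply, Prod.mk_add_mk, add_zero, zero_add]
  rw [hΨeq]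
  have h1s : ContDiff ℝ ∞ fun q => e₁ (a q) := e₁.contDiff.comp has
  have h2s : ContDiff ℝ ∞ fun q => e₂ (b q) := e₂.contDiff.comp hbs
  have h3s : ContDiff ℝ ∞ fun q => e₃ (c q) := e₃.contDiff.comp hcs
  have h23s : ContDiff ℝ ∞ ((fun q => e₂ (b q)) + fun q => e₃ (c q)) := h2s.add h3s
  rw [iteratedFDeriv_add_apply (f := fun q => e₁ (a q)) (g := (fun q => e₂ (b q)) + fun q => e₃ (c q))
      (h1s.of_le (by exact_mod_cast le_top)).contDiffAt (h23s.of_le (by exact_mod_cast le_top)).contDiffAt,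
    iteratedFDeriv_add_apply (f := fun q => e₂ (b q)) (g := fun q => e₃ (c q))
      (h2s.of_le (by exact_mod_cast le_top)).contDiffAt (h3s.of_le (by exact_mod_cast le_top)).contDiffAt]
  have b1 := (norm_iteratedFDeriv_clm_comp_le e₁ has i q).trans
    ((mul_le_of_le_one_left (norm_nonneg _) hne₁).trans da)
  have b2 := (norm_iteratedFDeriv_clm_comp_le e₂ hbs i q).trans
    ((mul_le_of_le_one_left (norm_nonneg _) hne₂).trans db)
  have b3 := (norm_iteratedFDeriv_clm_comp_le e₃ hcs i q).trans
    ((mul_le_of_le_one_left (norm_nonneg _) hne₃).trans dc)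
  refine (norm_add_le _ _).trans ((add_le_add b1 ((norm_add_le _ _).trans (add_le_add b2 b3))).trans ?_)
  have h48 : (4 : ℝ) ^ i ≤ 8 ^ i := pow_le_pow_left₀ (by norm_num) (by norm_num) i
  have h8 : (1 : ℝ) ≤ 8 ^ i := one_le_pow₀ (by norm_num)
  have hk1 : (1 + Z) ≤ 8 ^ i * (1 + T') * (1 + Z) :=
    le_mul_of_one_le_left (by positivity) (by nlinarith)
  have hk2 : (4 : ℝ) ^ i * (1 + T') ≤ 8 ^ i * (1 + T') * (1 + Z) := by
    calc (4 : ℝ) ^ i * (1 + T') ≤ 8 ^ i * (1 + T') := mul_le_mul_of_nonneg_right h48 (by linarith)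
      _ ≤ 8 ^ i * (1 + T') * (1 + Z) := le_mul_of_one_le_right (by positivity) (by linarith)
  rw [← hZ] at db dc
  linarith

end Psi

/-! ## Closure properties of the weighted two-parameter class

For `H : (ℝ × ℝ) × (ℝ × E × E) → F'` we use, written out, the hypotheses
"`Dec2 H`": `∀ n k T', ∃ C, ∀ q, q.1 ∈ [0,1]² → |q.2.1| ≤ T' → (1 + ‖q.2.2‖)^k ‖D^n H q‖ ≤ C`,
and "`Bdd2 H`" (the same without the weight). -/

section Classes

variable {F' : Type*} [NormedAddCommGroup F'] [NormedSpace ℝ F']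

/-- `Dec2 → Bdd2`. [folklore] -/
theorem bdd2_of_dec2 {H : (ℝ × ℝ) × (ℝ × E × E) → F'}
    (d : ∀ (n k : ℕ) (T' : ℝ), ∃ C : ℝ, ∀ q : (ℝ × ℝ) × (ℝ × E × E), q.1 ∈ Icc (0 : ℝ) 1 ×ˢ Icc (0 : ℝ) 1 →
      |q.2.1| ≤ T' → (1 + ‖q.2.2‖) ^ k * ‖iteratedFDeriv ℝ n H q‖ ≤ C) :
    ∀ (n : ℕ) (T' : ℝ), ∃ C : ℝ, ∀ q : (ℝ × ℝ) × (ℝ × E × E), q.1 ∈ Icc (0 : ℝ) 1 ×ˢ Icc (0 : ℝ) 1 →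
      |q.2.1| ≤ T' → ‖iteratedFDeriv ℝ n H q‖ ≤ C := by
  intro n T'
  obtain ⟨C, hC⟩ := d n 0 T'
  exact ⟨C, fun q hq ht => by simpa using hC q hq ht⟩

/-- **Products**: `Bdd2 · Dec2 ⊆ Dec2` (Leibniz). [folklore] -/
theorem dec2_mul {H₁ H₂ : (ℝ × ℝ) × (ℝ × E × E) → ℝ}
    (h₁ : ContDiff ℝ ∞ H₁) (h₂ : ContDiff ℝ ∞ H₂)
    (b₁ : ∀ (n : ℕ) (T' : ℝ), ∃ C : ℝ, ∀ q : (ℝ × ℝ) × (ℝ × E × E), q.1 ∈ Icc (0 : ℝ) 1 ×ˢ Icc (0 : ℝ) 1 →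
      |q.2.1| ≤ T' → ‖iteratedFDeriv ℝ n H₁ q‖ ≤ C)
    (d₂ : ∀ (n k : ℕ) (T' : ℝ), ∃ C : ℝ, ∀ q : (ℝ × ℝ) × (ℝ × E × E), q.1 ∈ Icc (0 : ℝ) 1 ×ˢ Icc (0 : ℝ) 1 →
      |q.2.1| ≤ T' → (1 + ‖q.2.2‖) ^ k * ‖iteratedFDeriv ℝ n H₂ q‖ ≤ C) :
    ∀ (n k : ℕ) (T' : ℝ), ∃ C : ℝ, ∀ q : (ℝ × ℝ) × (ℝ × E × E), q.1 ∈ Icc (0 : ℝ) 1 ×ˢ Icc (0 : ℝ) 1 →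
      |q.2.1| ≤ T' → (1 + ‖q.2.2‖) ^ k * ‖iteratedFDeriv ℝ n (fun q => H₁ q * H₂ q) q‖ ≤ C := by
  intro n k T'
  choose C₁ hC₁ using fun i : ℕ => b₁ i T'
  choose C₂ hC₂ using fun i : ℕ => d₂ i k T'
  refine ⟨∑ i ∈ Finset.range (n + 1), (n.choose i : ℝ) * |C₁ i| * |C₂ (n - i)|, fun q hq ht => ?_⟩
  have hleib := norm_iteratedFDeriv_mul_le (n := n) h₁ h₂ q (by exact_mod_cast le_top)
  calc (1 + ‖q.2.2‖) ^ k * ‖iteratedFDeriv ℝ n (fun q => H₁ q * H₂ q) q‖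
      ≤ (1 + ‖q.2.2‖) ^ k * ∑ i ∈ Finset.range (n + 1), (n.choose i : ℝ) * ‖iteratedFDeriv ℝ i H₁ q‖ *
          ‖iteratedFDeriv ℝ (n - i) H₂ q‖ := mul_le_mul_of_nonneg_left hleib (by positivity)
    _ = ∑ i ∈ Finset.range (n + 1), (n.choose i : ℝ) * ‖iteratedFDeriv ℝ i H₁ q‖ *
          ((1 + ‖q.2.2‖) ^ k * ‖iteratedFDeriv ℝ (n - i) H₂ q‖) := by
        rw [Finset.mul_sum]; exact Finset.sum_congr rfl fun i _ => by ring
    _ ≤ ∑ i ∈ Finset.range (n + 1), (n.choose i : ℝ) * |C₁ i| * |C₂ (n - i)| :=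
        Finset.sum_le_sum fun i _ => mul_le_mul (mul_le_mul_of_nonneg_left ((hC₁ i q hq ht).trans (le_abs_self _))
          (by positivity)) ((hC₂ (n - i) q hq ht).trans (le_abs_self _)) (by positivity) (by positivity)

/-- **Scalar post-composition**: `φ ∘ Bdd2 ⊆ Bdd2` for smooth `φ : ℝ → ℝ` (the range is bounded on
the region, so all derivatives of `φ` are bounded there; crude Faà di Bruno). [folklore] -/
theorem bdd2_comp_scalar {φ : ℝ → ℝ} (hφ : ContDiff ℝ ∞ φ) {H : (ℝ × ℝ) × (ℝ × E × E) → ℝ}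
    (hH : ContDiff ℝ ∞ H)
    (b : ∀ (n : ℕ) (T' : ℝ), ∃ C : ℝ, ∀ q : (ℝ × ℝ) × (ℝ × E × E), q.1 ∈ Icc (0 : ℝ) 1 ×ˢ Icc (0 : ℝ) 1 →
      |q.2.1| ≤ T' → ‖iteratedFDeriv ℝ n H q‖ ≤ C) :
    ∀ (n : ℕ) (T' : ℝ), ∃ C : ℝ, ∀ q : (ℝ × ℝ) × (ℝ × E × E), q.1 ∈ Icc (0 : ℝ) 1 ×ˢ Icc (0 : ℝ) 1 →
      |q.2.1| ≤ T' → ‖iteratedFDeriv ℝ n (fun q => φ (H q)) q‖ ≤ C := by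
  intro n T'
  choose C hC using fun i : ℕ => b i T'
  -- range of `H` on the region
  have hrange : ∀ q : (ℝ × ℝ) × (ℝ × E × E), q.1 ∈ Icc (0 : ℝ) 1 ×ˢ Icc (0 : ℝ) 1 → |q.2.1| ≤ T' →
      H q ∈ Icc (-|C 0|) |C 0| := fun q hq ht => by
    have h := hC 0 q hq ht
    rw [norm_iteratedFDeriv_zero, Real.norm_eq_abs] at h
    exact ⟨by linarith [neg_abs_le (H q), le_abs_self (C 0)], (le_abs_self _).trans (h.trans (le_abs_self _))⟩
  -- bounds for the derivatives of `φ` on that interval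
  have hΦ : ∀ i : ℕ, ∃ M : ℝ, ∀ y ∈ Icc (-|C 0|) |C 0|, ‖iteratedFDeriv ℝ i φ y‖ ≤ M := fun i =>
    isCompact_Icc.exists_bound_of_continuousOn ((hφ.continuous_iteratedFDeriv (by exact_mod_cast le_top)).continuousOn)
  choose M hM using hΦ
  set Φ : ℝ := ∑ i ∈ Finset.range (n + 1), |M i| with hΦdef
  set D : ℝ := 1 + ∑ i ∈ Finset.range (n + 1), |C i| with hD
  refine ⟨(Nat.factorial n : ℝ) * Φ * D ^ n, fun q hq ht => ?_⟩
  have hD1 : 1 ≤ D := by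
    rw [hD]; linarith [Finset.sum_nonneg fun i (_ : i ∈ Finset.range (n + 1)) => abs_nonneg (C i)]
  have h := norm_iteratedFDeriv_comp_le (g := φ) (f := H) (n := n) (N := ∞) hφ hH (by exact_mod_cast le_top) q
    (C := Φ) (D := D) (fun i hi => ?_) (fun i hi1 hin => ?_)
  · exact h
  · refine (hM i (H q) (hrange q hq ht)).trans ((le_abs_self _).trans ?_)
    rw [hΦdef]
    exact Finset.single_le_sum (fun j _ => abs_nonneg (M j)) (Finset.mem_range.2 (Nat.lt_succ_of_le hi))
  · refine (hC i q hq ht).trans ((le_abs_self _).trans ?_)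
    have hle : |C i| ≤ D := by
      rw [hD]
      have := Finset.single_le_sum (fun j _ => abs_nonneg (C j)) (Finset.mem_range.2 (Nat.lt_succ_of_le hin))
      linarith
    calc |C i| ≤ D := hle
      _ = D ^ 1 := (pow_one D).symm
      _ ≤ D ^ i := pow_le_pow_right₀ hD1 hi1

/-- Pointwise bound for an affine reparametrisation with linear part of norm `≤ 1`. [folklore] -/
theorem norm_iteratedFDeriv_comp_affine_le {P' : Type*} [NormedAddCommGroup P'] [NormedSpace ℝ P']
    {H : (ℝ × ℝ) × (ℝ × E × E) → F'} (hH : ContDiff ℝ ∞ H) (c : (ℝ × ℝ) × (ℝ × E × E))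
    (L : P' →L[ℝ] (ℝ × ℝ) × (ℝ × E × E)) (hL : ‖L‖ ≤ 1) (n : ℕ) (q : P') :
    ‖iteratedFDeriv ℝ n (fun q => H (c + L q)) q‖ ≤ ‖iteratedFDeriv ℝ n H (c + L q)‖ := by
  have hcomp : (fun q => H (c + L q)) = (fun y => H (c + y)) ∘ L := by funext q; rfl
  have hs : ContDiff ℝ ∞ fun y : (ℝ × ℝ) × (ℝ × E × E) => H (c + y) := hH.comp (contDiff_const.add contDiff_id)
  rw [hcomp, L.iteratedFDeriv_comp_right hs q (by exact_mod_cast le_top), iteratedFDeriv_comp_add_left]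
  refine (ContinuousMultilinearMap.norm_compContinuousLinearMap_le _ _).trans ?_
  rw [Finset.prod_const, Finset.card_univ, Fintype.card_fin]
  exact (mul_le_mul_of_nonneg_left (pow_le_one₀ (norm_nonneg _) hL) (norm_nonneg _)).trans (le_of_eq (mul_one _))

/-- **Affine reparametrisation of the parameters** preserving the space-time point and the
parameter square: `Dec2` is stable. [folklore] -/
theorem dec2_comp_affine {H : (ℝ × ℝ) × (ℝ × E × E) → F'} (hH : ContDiff ℝ ∞ H)
    (d : ∀ (n k : ℕ) (T' : ℝ), ∃ C : ℝ, ∀ q : (ℝ × ℝ) × (ℝ × E × E), q.1 ∈ Icc (0 : ℝ) 1 ×ˢ Icc (0 : ℝ) 1 →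
      |q.2.1| ≤ T' → (1 + ‖q.2.2‖) ^ k * ‖iteratedFDeriv ℝ n H q‖ ≤ C)
    (c : (ℝ × ℝ) × (ℝ × E × E)) (L : (ℝ × ℝ) × (ℝ × E × E) →L[ℝ] (ℝ × ℝ) × (ℝ × E × E)) (hL : ‖L‖ ≤ 1)
    (hp : ∀ q, (c + L q).2 = q.2)
    (hreg : ∀ q : (ℝ × ℝ) × (ℝ × E × E), q.1 ∈ Icc (0 : ℝ) 1 ×ˢ Icc (0 : ℝ) 1 → (c + L q).1 ∈ Icc (0 : ℝ) 1 ×ˢ Icc (0 : ℝ) 1) :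
    ∀ (n k : ℕ) (T' : ℝ), ∃ C : ℝ, ∀ q : (ℝ × ℝ) × (ℝ × E × E), q.1 ∈ Icc (0 : ℝ) 1 ×ˢ Icc (0 : ℝ) 1 →
      |q.2.1| ≤ T' → (1 + ‖q.2.2‖) ^ k * ‖iteratedFDeriv ℝ n (fun q => H (c + L q)) q‖ ≤ C := by
  intro n k T'
  obtain ⟨C, hC⟩ := d n k T'
  refine ⟨C, fun q hq ht => ?_⟩
  have h1 := norm_iteratedFDeriv_comp_affine_le hH c L hL n q
  have h2 := hC (c + L q) (hreg q hq) (by rw [hp]; exact ht)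
  rw [hp] at h2
  exact (mul_le_mul_of_nonneg_left h1 (by positivity)).trans h2

/-- The embedding `q ↦ ((0, θ'), p)` of the region at fixed first parameter, as a continuous
linear map of norm `≤ 1`. [folklore] -/
theorem exists_sliceCLM :
    ∃ L : (ℝ × ℝ) × (ℝ × E × E) →L[ℝ] (ℝ × ℝ) × (ℝ × E × E), (∀ q, L q = (((0 : ℝ), q.1.2), q.2)) ∧ ‖L‖ ≤ 1 := by
  refine ⟨((0 : (ℝ × ℝ) × (ℝ × E × E) →L[ℝ] ℝ).prod ((ContinuousLinearMap.snd ℝ ℝ ℝ).comp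
    (ContinuousLinearMap.fst ℝ (ℝ × ℝ) (ℝ × E × E)))).prod (ContinuousLinearMap.snd ℝ (ℝ × ℝ) (ℝ × E × E)),
    fun q => rfl, ?_⟩
  refine ContinuousLinearMap.opNorm_le_bound _ zero_le_one fun q => ?_
  rw [one_mul]
  show ‖((((0 : ℝ), q.1.2) : ℝ × ℝ), q.2)‖ ≤ ‖q‖
  simp only [Prod.norm_def, norm_zero, Real.norm_eq_abs]
  refine max_le (max_le (le_trans (norm_nonneg q.1) (le_max_left _ _)) ?_) (le_max_right _ _)
  exact le_trans (by rw [← Real.norm_eq_abs]; exact norm_snd_le q.1) (le_max_left _ _)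

/-- **Integration over the first parameter**: `q ↦ ∫₀¹ H((θ, θ'), p) dθ` is smooth and in `Dec2`
when `H` is. [folklore] -/
theorem dec2_intervalIntegral [FiniteDimensional ℝ E] [CompleteSpace F'] {H : (ℝ × ℝ) × (ℝ × E × E) → F'}
    (hH : ContDiff ℝ ∞ H)
    (d : ∀ (n k : ℕ) (T' : ℝ), ∃ C : ℝ, ∀ q : (ℝ × ℝ) × (ℝ × E × E), q.1 ∈ Icc (0 : ℝ) 1 ×ˢ Icc (0 : ℝ) 1 →
      |q.2.1| ≤ T' → (1 + ‖q.2.2‖) ^ k * ‖iteratedFDeriv ℝ n H q‖ ≤ C) :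
    ContDiff ℝ ∞ (fun q : (ℝ × ℝ) × (ℝ × E × E) => ∫ θ in (0 : ℝ)..1, H ((θ, q.1.2), q.2)) ∧
    ∀ (n k : ℕ) (T' : ℝ), ∃ C : ℝ, ∀ q : (ℝ × ℝ) × (ℝ × E × E), q.1 ∈ Icc (0 : ℝ) 1 ×ˢ Icc (0 : ℝ) 1 →
      |q.2.1| ≤ T' → (1 + ‖q.2.2‖) ^ k *
        ‖iteratedFDeriv ℝ n (fun q : (ℝ × ℝ) × (ℝ × E × E) => ∫ θ in (0 : ℝ)..1, H ((θ, q.1.2), q.2)) q‖ ≤ C := by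
  obtain ⟨L, hL, hLn⟩ := exists_sliceCLM (E := E)
  set c : ℝ → (ℝ × ℝ) × (ℝ × E × E) := fun θ => ((θ, 0), 0) with hc
  have hcL : ∀ θ (q : (ℝ × ℝ) × (ℝ × E × E)), c θ + L q = ((θ, q.1.2), q.2) := fun θ q => by
    rw [hL]; simp [hc]
  set G : ℝ × ((ℝ × ℝ) × (ℝ × E × E)) → F' := fun r => H ((r.1, r.2.1.2), r.2.2) with hG
  have hGs : ContDiff ℝ ∞ G := hH.comp ((contDiff_fst.prodMk (contDiff_snd.comp (contDiff_fst.comp contDiff_snd))).prodMk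
    (contDiff_snd.comp contDiff_snd))
  set μ : Measure ℝ := (volume : Measure ℝ).restrict (Ioc 0 1) with hμ
  haveI : IsFiniteMeasure μ := ⟨by rw [hμ, Measure.restrict_apply_univ]; exact measure_Ioc_lt_top⟩
  have hK : ∀ᵐ θ ∂μ, id θ ∈ Icc (0 : ℝ) 1 := by
    rw [hμ]; exact (ae_restrict_mem measurableSet_Ioc).mono fun θ hθ => Ioc_subset_Icc_self hθ
  have heq : (fun q : (ℝ × ℝ) × (ℝ × E × E) => ∫ θ in (0 : ℝ)..1, H ((θ, q.1.2), q.2)) = fun q => ∫ θ, G (id θ, q) ∂μ := by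
    funext q; rw [intervalIntegral.integral_of_le zero_le_one]; rfl
  rw [heq]
  refine ⟨contDiff_parametric_integral (μ := μ) measurable_id isCompact_Icc hK hGs, fun n k T' => ?_⟩
  obtain ⟨C, hC⟩ := d n k T'
  refine ⟨max C 0, fun q hq ht => ?_⟩
  have hw : 0 < (1 + ‖q.2.2‖) ^ k := by positivity
  -- pointwise bound of the sections
  have hpt : ∀ θ ∈ Ioc (0 : ℝ) 1, ‖iteratedFDeriv ℝ n (fun r : (ℝ × ℝ) × (ℝ × E × E) => G (id θ, r)) q‖ ≤ max C 0 / (1 + ‖q.2.2‖) ^ k := by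
    intro θ hθ
    have hsec : (fun r : (ℝ × ℝ) × (ℝ × E × E) => G (id θ, r)) = fun r => H (c θ + L r) := by
      funext r; rw [hcL]; rfl
    rw [hsec, le_div_iff₀ hw, mul_comm]
    refine (mul_le_mul_of_nonneg_left (norm_iteratedFDeriv_comp_affine_le hH (c θ) L hLn n q) hw.le).trans ?_
    have hreg : (c θ + L q).1 ∈ Icc (0 : ℝ) 1 ×ˢ Icc (0 : ℝ) 1 := by
      rw [hcL]; exact ⟨Ioc_subset_Icc_self hθ, hq.2⟩
    have h := hC (c θ + L q) hreg (by rw [hcL]; exact ht)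
    rw [hcL] at h ⊢
    exact h.trans (le_max_left _ _)
  have hnorm := norm_iteratedFDeriv_parametric_integral_le (μ := μ) measurable_id isCompact_Icc hK hGs n q
  rw [mul_comm, ← le_div_iff₀ hw]
  refine hnorm.trans ?_
  have hint : Integrable (fun θ => ‖iteratedFDeriv ℝ n (fun r : (ℝ × ℝ) × (ℝ × E × E) => G (id θ, r)) q‖) μ :=
    (integrable_iteratedFDeriv_section (μ := μ) measurable_id isCompact_Icc hK hGs n q).norm
  calc ∫ θ, ‖iteratedFDeriv ℝ n (fun r : (ℝ × ℝ) × (ℝ × E × E) => G (id θ, r)) q‖ ∂μ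
      ≤ ∫ θ, max C 0 / (1 + ‖q.2.2‖) ^ k ∂μ := by
        rw [hμ]
        exact setIntegral_mono_on (by rw [hμ] at hint; exact hint) (integrableOn_const (by
          rw [Real.volume_Ioc]; exact ENNReal.ofReal_lt_top |>.ne) |> fun h => h) measurableSet_Ioc hpt
    _ = max C 0 / (1 + ‖q.2.2‖) ^ k := by
        rw [MeasureTheory.setIntegral_const, Real.volume_real_Ioc_of_le zero_le_one, sub_zero, one_smul]

/-- **Composition with the substitution map**: for a space-time function `G` with weighted
bounds on every slab `|t| ≤ T'`, `q ↦ G(Ψ q)` is in `Dec2` (crude Faà di Bruno with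
`norm_iteratedFDeriv_psi_le`; the polynomial growth `(1 + ‖(x,v)‖)^n` of the derivatives of `Ψ`
and the shift `x - τ v` (`|τ| ≤ T'`) are absorbed by the weights). [folklore] -/
theorem dec2_comp_psi [FiniteDimensional ℝ E] {G : ℝ × E × E → F'} (hG : ContDiff ℝ ∞ G)
    (d : ∀ (n k : ℕ) (T' : ℝ), ∃ C : ℝ, ∀ p : ℝ × E × E, |p.1| ≤ T' →
      (1 + ‖p.2‖) ^ k * ‖iteratedFDeriv ℝ n G p‖ ≤ C) :
    ∀ (n k : ℕ) (T' : ℝ), ∃ C : ℝ, ∀ q : (ℝ × ℝ) × (ℝ × E × E), q.1 ∈ Icc (0 : ℝ) 1 ×ˢ Icc (0 : ℝ) 1 →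
      |q.2.1| ≤ T' → (1 + ‖q.2.2‖) ^ k * ‖iteratedFDeriv ℝ n (fun q : (ℝ × ℝ) × (ℝ × E × E) =>
        G (q.2.1 * q.1.2 * q.1.1, q.2.2.1 - (q.2.1 - q.2.1 * q.1.2 * q.1.1) • q.2.2.2, q.2.2.2)) q‖ ≤ C := by
  intro n k T'
  by_cases hT' : T' < 0
  · exact ⟨0, fun q _ ht => absurd (ht.trans_lt hT') (not_lt.2 (abs_nonneg _))⟩
  rw [not_lt] at hT'
  choose Cst hCst using fun i : ℕ => d i (k + n) T'
  set Cm : ℝ := ∑ i ∈ Finset.range (n + 1), |Cst i| with hCm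
  have hCm0 : 0 ≤ Cm := Finset.sum_nonneg fun i _ => abs_nonneg _
  refine ⟨(Nat.factorial n : ℝ) * Cm * (6 * 8 ^ n * (1 + T')) ^ n * (1 + T') ^ (k + n), fun q hq ht => ?_⟩
  set Ψ : (ℝ × ℝ) × (ℝ × E × E) → ℝ × E × E := fun q =>
    (q.2.1 * q.1.2 * q.1.1, q.2.2.1 - (q.2.1 - q.2.1 * q.1.2 * q.1.1) • q.2.2.2, q.2.2.2) with hΨ
  have hΨs : ContDiff ℝ ∞ Ψ := by
    have ha : ContDiff ℝ ∞ fun q : (ℝ × ℝ) × (ℝ × E × E) => q.2.1 * q.1.2 * q.1.1 :=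
      ((contDiff_fst.comp contDiff_snd).mul (contDiff_snd.comp contDiff_fst)).mul (contDiff_fst.comp contDiff_fst)
    exact ha.prodMk (((contDiff_fst.comp (contDiff_snd.comp contDiff_snd)).sub
      (((contDiff_fst.comp contDiff_snd).sub ha).smul (contDiff_snd.comp (contDiff_snd.comp contDiff_snd)))).prodMk
      (contDiff_snd.comp (contDiff_snd.comp contDiff_snd)))
  set Z : ℝ := ‖q.2.2‖ with hZ
  have hZ0 : 0 ≤ Z := norm_nonneg _
  obtain ⟨⟨hθ0, hθ1⟩, ⟨hθ'0, hθ'1⟩⟩ := hq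
  -- the point `Ψ q`: time in the slab, spatial part a shift of `q.2.2`
  set τ : ℝ := q.2.1 - q.2.1 * q.1.2 * q.1.1 with hτ
  have hτT : |τ| ≤ T' := by
    have h1 : τ = q.2.1 * (1 - q.1.2 * q.1.1) := by rw [hτ]; ring
    have hnn : (0 : ℝ) ≤ 1 - q.1.2 * q.1.1 := sub_nonneg.2 (mul_le_one₀ hθ'1 hθ0 hθ1)
    rw [h1, abs_mul, abs_of_nonneg hnn]
    calc |q.2.1| * (1 - q.1.2 * q.1.1) ≤ |q.2.1| * 1 :=
          mul_le_mul_of_nonneg_left (by nlinarith [mul_nonneg hθ'0 hθ0]) (abs_nonneg _)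
      _ ≤ T' := by rw [mul_one]; exact ht
  have hΨ1 : |(Ψ q).1| ≤ T' := by
    simp only [hΨ]
    rw [abs_mul, abs_mul, abs_of_nonneg hθ'0, abs_of_nonneg hθ0]
    calc |q.2.1| * q.1.2 * q.1.1 ≤ T' * 1 * 1 := by gcongr
      _ = T' := by ring
  have hΨ2 : (Ψ q).2 = (q.2.2.1 - τ • q.2.2.2, q.2.2.2) := by simp only [hΨ, hτ]
  have hshift : 1 + Z ≤ (1 + T') * (1 + ‖(Ψ q).2‖) := by
    rw [hΨ2, hZ]
    have h := norm_le_shift q.2.2.1 q.2.2.2 τ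
    have hp : ‖q.2.2‖ = ‖(q.2.2.1, q.2.2.2)‖ := by rfl
    rw [hp]
    nlinarith [abs_nonneg τ, norm_nonneg (q.2.2.1 - τ • q.2.2.2, q.2.2.2)]
  -- Faà di Bruno
  set D : ℝ := 6 * 8 ^ n * (1 + T') * (1 + Z) with hD
  have hD1 : 1 ≤ D := by
    have h8 : (1 : ℝ) ≤ 8 ^ n := one_le_pow₀ (by norm_num)
    have h1 : (1 : ℝ) ≤ 6 * 8 ^ n := by nlinarith
    have h2 : (1 : ℝ) ≤ 6 * 8 ^ n * (1 + T') := one_le_mul_of_one_le_of_one_le h1 (by linarith)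
    rw [hD]; exact one_le_mul_of_one_le_of_one_le h2 (by linarith)
  have hwpos : 0 < (1 + ‖(Ψ q).2‖) ^ (k + n) := by positivity
  set Cq : ℝ := Cm / (1 + ‖(Ψ q).2‖) ^ (k + n) with hCq
  have hC : ∀ i, i ≤ n → ‖iteratedFDeriv ℝ i G (Ψ q)‖ ≤ Cq := fun i hi => by
    rw [hCq, le_div_iff₀ hwpos, mul_comm]
    refine (hCst i (Ψ q) hΨ1).trans ((le_abs_self _).trans ?_)
    exact Finset.single_le_sum (fun j _ => abs_nonneg (Cst j)) (Finset.mem_range.2 (Nat.lt_succ_of_le hi))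
  have hDb : ∀ i, 1 ≤ i → i ≤ n → ‖iteratedFDeriv ℝ i Ψ q‖ ≤ D ^ i := fun i hi1 hin => by
    have h := norm_iteratedFDeriv_psi_le hT' q ⟨⟨hθ0, hθ1⟩, ⟨hθ'0, hθ'1⟩⟩ ht i
    refine h.trans ?_
    calc 6 * 8 ^ i * (1 + T') * (1 + ‖q.2.2‖) ≤ D := by
          rw [hD, ← hZ]
          have := pow_le_pow_right₀ (by norm_num : (1 : ℝ) ≤ 8) hin
          nlinarith [mul_nonneg (by linarith : (0 : ℝ) ≤ 1 + T') hZ0]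
      _ = D ^ 1 := (pow_one D).symm
      _ ≤ D ^ i := pow_le_pow_right₀ hD1 hi1
  have hFdB := norm_iteratedFDeriv_comp_le (g := G) (f := Ψ) (n := n) (N := ∞) hG hΨs (by exact_mod_cast le_top) q hC hDb
  -- weights
  have hCq0 : 0 ≤ Cq := div_nonneg hCm0 hwpos.le
  calc (1 + ‖q.2.2‖) ^ k * ‖iteratedFDeriv ℝ n (G ∘ Ψ) q‖
      ≤ (1 + Z) ^ k * ((Nat.factorial n : ℝ) * Cq * D ^ n) := by
        rw [← hZ]; exact mul_le_mul_of_nonneg_left hFdB (by positivity)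
    _ = (Nat.factorial n : ℝ) * Cm * (6 * 8 ^ n * (1 + T')) ^ n *
          ((1 + Z) ^ (k + n) / (1 + ‖(Ψ q).2‖) ^ (k + n)) := by
        rw [hCq, hD, pow_add, mul_pow]; ring
    _ ≤ (Nat.factorial n : ℝ) * Cm * (6 * 8 ^ n * (1 + T')) ^ n * (1 + T') ^ (k + n) := by
        refine mul_le_mul_of_nonneg_left ?_ (by positivity)
        rw [div_le_iff₀ hwpos, ← mul_pow]
        exact pow_le_pow_left₀ (by positivity) hshift _

/-- `Dec2` is stable under sums. [folklore] -/
theorem dec2_add {H₁ H₂ : (ℝ × ℝ) × (ℝ × E × E) → F'} (h₁ : ContDiff ℝ ∞ H₁) (h₂ : ContDiff ℝ ∞ H₂)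
    (d₁ : ∀ (n k : ℕ) (T' : ℝ), ∃ C : ℝ, ∀ q : (ℝ × ℝ) × (ℝ × E × E), q.1 ∈ Icc (0 : ℝ) 1 ×ˢ Icc (0 : ℝ) 1 →
      |q.2.1| ≤ T' → (1 + ‖q.2.2‖) ^ k * ‖iteratedFDeriv ℝ n H₁ q‖ ≤ C)
    (d₂ : ∀ (n k : ℕ) (T' : ℝ), ∃ C : ℝ, ∀ q : (ℝ × ℝ) × (ℝ × E × E), q.1 ∈ Icc (0 : ℝ) 1 ×ˢ Icc (0 : ℝ) 1 →
      |q.2.1| ≤ T' → (1 + ‖q.2.2‖) ^ k * ‖iteratedFDeriv ℝ n H₂ q‖ ≤ C) :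
    ∀ (n k : ℕ) (T' : ℝ), ∃ C : ℝ, ∀ q : (ℝ × ℝ) × (ℝ × E × E), q.1 ∈ Icc (0 : ℝ) 1 ×ˢ Icc (0 : ℝ) 1 →
      |q.2.1| ≤ T' → (1 + ‖q.2.2‖) ^ k * ‖iteratedFDeriv ℝ n (fun q => H₁ q + H₂ q) q‖ ≤ C := by
  intro n k T'
  obtain ⟨C₁, hC₁⟩ := d₁ n k T'
  obtain ⟨C₂, hC₂⟩ := d₂ n k T'
  refine ⟨C₁ + C₂, fun q hq ht => ?_⟩
  have heq : (fun q => H₁ q + H₂ q) = H₁ + H₂ := rfl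
  rw [heq, iteratedFDeriv_add_apply (h₁.of_le (by exact_mod_cast le_top)).contDiffAt (h₂.of_le (by exact_mod_cast le_top)).contDiffAt]
  calc (1 + ‖q.2.2‖) ^ k * ‖iteratedFDeriv ℝ n H₁ q + iteratedFDeriv ℝ n H₂ q‖
      ≤ (1 + ‖q.2.2‖) ^ k * (‖iteratedFDeriv ℝ n H₁ q‖ + ‖iteratedFDeriv ℝ n H₂ q‖) :=
        mul_le_mul_of_nonneg_left (norm_add_le _ _) (by positivity)
    _ ≤ C₁ + C₂ := by rw [mul_add]; exact add_le_add (hC₁ q hq ht) (hC₂ q hq ht)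

/-- `Dec2` is stable under differences. [folklore] -/
theorem dec2_sub {H₁ H₂ : (ℝ × ℝ) × (ℝ × E × E) → F'} (h₁ : ContDiff ℝ ∞ H₁) (h₂ : ContDiff ℝ ∞ H₂)
    (d₁ : ∀ (n k : ℕ) (T' : ℝ), ∃ C : ℝ, ∀ q : (ℝ × ℝ) × (ℝ × E × E), q.1 ∈ Icc (0 : ℝ) 1 ×ˢ Icc (0 : ℝ) 1 →
      |q.2.1| ≤ T' → (1 + ‖q.2.2‖) ^ k * ‖iteratedFDeriv ℝ n H₁ q‖ ≤ C)
    (d₂ : ∀ (n k : ℕ) (T' : ℝ), ∃ C : ℝ, ∀ q : (ℝ × ℝ) × (ℝ × E × E), q.1 ∈ Icc (0 : ℝ) 1 ×ˢ Icc (0 : ℝ) 1 →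
      |q.2.1| ≤ T' → (1 + ‖q.2.2‖) ^ k * ‖iteratedFDeriv ℝ n H₂ q‖ ≤ C) :
    ∀ (n k : ℕ) (T' : ℝ), ∃ C : ℝ, ∀ q : (ℝ × ℝ) × (ℝ × E × E), q.1 ∈ Icc (0 : ℝ) 1 ×ˢ Icc (0 : ℝ) 1 →
      |q.2.1| ≤ T' → (1 + ‖q.2.2‖) ^ k * ‖iteratedFDeriv ℝ n (fun q => H₁ q - H₂ q) q‖ ≤ C := by
  intro n k T'
  obtain ⟨C₁, hC₁⟩ := d₁ n k T'
  obtain ⟨C₂, hC₂⟩ := d₂ n k T'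
  refine ⟨C₁ + C₂, fun q hq ht => ?_⟩
  have heq : (fun q => H₁ q - H₂ q) = H₁ - H₂ := rfl
  rw [heq, iteratedFDeriv_sub_apply (h₁.of_le (by exact_mod_cast le_top)).contDiffAt (h₂.of_le (by exact_mod_cast le_top)).contDiffAt]
  calc (1 + ‖q.2.2‖) ^ k * ‖iteratedFDeriv ℝ n H₁ q - iteratedFDeriv ℝ n H₂ q‖
      ≤ (1 + ‖q.2.2‖) ^ k * (‖iteratedFDeriv ℝ n H₁ q‖ + ‖iteratedFDeriv ℝ n H₂ q‖) :=
        mul_le_mul_of_nonneg_left (norm_sub_le _ _) (by positivity)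
    _ ≤ C₁ + C₂ := by rw [mul_add]; exact add_le_add (hC₁ q hq ht) (hC₂ q hq ht)

/-- The coordinate functions `t` and `t θ'` are in `Bdd2`. [folklore] -/
theorem bdd2_coords :
    (∀ (n : ℕ) (T' : ℝ), ∃ C : ℝ, ∀ q : (ℝ × ℝ) × (ℝ × E × E), q.1 ∈ Icc (0 : ℝ) 1 ×ˢ Icc (0 : ℝ) 1 →
      |q.2.1| ≤ T' → ‖iteratedFDeriv ℝ n (fun q : (ℝ × ℝ) × (ℝ × E × E) => q.2.1) q‖ ≤ C) ∧
    (∀ (n : ℕ) (T' : ℝ), ∃ C : ℝ, ∀ q : (ℝ × ℝ) × (ℝ × E × E), q.1 ∈ Icc (0 : ℝ) 1 ×ˢ Icc (0 : ℝ) 1 →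
      |q.2.1| ≤ T' → ‖iteratedFDeriv ℝ n (fun q : (ℝ × ℝ) × (ℝ × E × E) => q.2.1 * q.1.2) q‖ ≤ C) := by
  obtain ⟨Lθ, Lθ', Lt, Lx, Lv, hθ, hθ', hLt, hLx, hLv, nθ, nθ', nt, nx, nv⟩ := psi_coords (E := E)
  have htf : (fun q : (ℝ × ℝ) × (ℝ × E × E) => q.2.1) = (Lt : _ → ℝ) := by funext q; rw [hLt]
  have htθ : (fun q : (ℝ × ℝ) × (ℝ × E × E) => q.2.1 * q.1.2) = fun q => Lt q * Lθ' q := by funext q; rw [hLt, hθ']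
  have dt : ∀ (T' : ℝ) (q : (ℝ × ℝ) × (ℝ × E × E)), |q.2.1| ≤ T' → ∀ i, ‖iteratedFDeriv ℝ i (Lt : _ → ℝ) q‖ ≤ max T' 1 :=
    fun T' q ht i => norm_iteratedFDeriv_coord_le Lt nt (by rw [hLt, Real.norm_eq_abs]; exact ht) i
  have dθ' : ∀ q : (ℝ × ℝ) × (ℝ × E × E), q.1 ∈ Icc (0 : ℝ) 1 ×ˢ Icc (0 : ℝ) 1 → ∀ i, ‖iteratedFDeriv ℝ i (Lθ' : _ → ℝ) q‖ ≤ 1 :=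
    fun q hq i => by
      have h := norm_iteratedFDeriv_coord_le Lθ' nθ' (V := 1)
        (by rw [hθ', Real.norm_eq_abs, abs_le]; exact ⟨by linarith [hq.2.1], hq.2.2⟩) i (q := q)
      simpa using h
  refine ⟨fun n T' => ⟨max T' 1, fun q hq ht => by rw [htf]; exact dt T' q ht n⟩,
    fun n T' => ⟨2 ^ n * max T' 1 * 1, fun q hq ht => ?_⟩⟩
  rw [htθ]
  exact norm_iteratedFDeriv_mul_le_two_pow Lt.contDiff Lθ'.contDiff (fun i _ => dt T' q ht i) (fun i _ => dθ' q hq i)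

/-- Schwartz-type data, viewed as a time-independent space-time function, have the weighted
bounds. [folklore] -/
theorem decST_of_data [FiniteDimensional ℝ E] {f₀ : E × E → F'} (hf₀ : ContDiff ℝ ∞ f₀)
    (df₀ : ∀ n k : ℕ, ∃ C : ℝ, ∀ z : E × E, (1 + ‖z‖) ^ k * ‖iteratedFDeriv ℝ n f₀ z‖ ≤ C) :
    ∀ (n k : ℕ) (T' : ℝ), ∃ C : ℝ, ∀ p : ℝ × E × E, |p.1| ≤ T' →
      (1 + ‖p.2‖) ^ k * ‖iteratedFDeriv ℝ n (fun p : ℝ × E × E => f₀ p.2) p‖ ≤ C := by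
  intro n k T'
  obtain ⟨C, hC⟩ := df₀ n k
  refine ⟨C, fun p _ => ?_⟩
  have hcomp : (fun p : ℝ × E × E => f₀ p.2) = f₀ ∘ (ContinuousLinearMap.snd ℝ ℝ (E × E)) := rfl
  rw [hcomp, (ContinuousLinearMap.snd ℝ ℝ (E × E)).iteratedFDeriv_comp_right hf₀ p (by exact_mod_cast le_top)]
  refine le_trans (mul_le_mul_of_nonneg_left ((ContinuousMultilinearMap.norm_compContinuousLinearMap_le _ _).trans ?_)
    (by positivity)) (hC p.2)
  rw [Finset.prod_const, Finset.card_univ, Fintype.card_fin]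
  refine (mul_le_mul_of_nonneg_left (pow_le_one₀ (norm_nonneg _) (ContinuousLinearMap.norm_snd_le ℝ ℝ (E × E)))
    (norm_nonneg _)).trans (le_of_eq ?_)
  rw [mul_one]; rfl

/-- Parameter maps used in the assembly: swap `(θ, θ') ↦ (θ', θ)` and `(θ, θ') ↦ (θ, 0)`, as
continuous linear maps of norm `≤ 1` fixing the space-time point. [folklore] -/
theorem exists_paramCLMs :
    (∃ L : (ℝ × ℝ) × (ℝ × E × E) →L[ℝ] (ℝ × ℝ) × (ℝ × E × E), (∀ q, L q = ((q.1.2, q.1.1), q.2)) ∧ ‖L‖ ≤ 1) ∧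
    (∃ L : (ℝ × ℝ) × (ℝ × E × E) →L[ℝ] (ℝ × ℝ) × (ℝ × E × E), (∀ q, L q = ((q.1.1, (0 : ℝ)), q.2)) ∧ ‖L‖ ≤ 1) ∧
    (∃ L : ℝ × E × E →L[ℝ] (ℝ × ℝ) × (ℝ × E × E), (∀ p, L p = (((0 : ℝ), (0 : ℝ)), p)) ∧ ‖L‖ ≤ 1) := by
  refine ⟨⟨(((ContinuousLinearMap.snd ℝ ℝ ℝ).comp (ContinuousLinearMap.fst ℝ (ℝ × ℝ) (ℝ × E × E))).prod
      ((ContinuousLinearMap.fst ℝ ℝ ℝ).comp (ContinuousLinearMap.fst ℝ (ℝ × ℝ) (ℝ × E × E)))).prod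
      (ContinuousLinearMap.snd ℝ (ℝ × ℝ) (ℝ × E × E)), fun q => rfl, ?_⟩,
    ⟨(((ContinuousLinearMap.fst ℝ ℝ ℝ).comp (ContinuousLinearMap.fst ℝ (ℝ × ℝ) (ℝ × E × E))).prod
      (0 : (ℝ × ℝ) × (ℝ × E × E) →L[ℝ] ℝ)).prod (ContinuousLinearMap.snd ℝ (ℝ × ℝ) (ℝ × E × E)), fun q => rfl, ?_⟩,
    ⟨ContinuousLinearMap.inr ℝ (ℝ × ℝ) (ℝ × E × E), fun p => rfl, ContinuousLinearMap.norm_inr_le_one ℝ _ _⟩⟩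
  · refine ContinuousLinearMap.opNorm_le_bound _ zero_le_one fun q => ?_
    rw [one_mul]
    show ‖(((q.1.2, q.1.1) : ℝ × ℝ), q.2)‖ ≤ ‖q‖
    simp only [Prod.norm_def]
    rw [max_comm ‖q.1.2‖ ‖q.1.1‖]
  · refine ContinuousLinearMap.opNorm_le_bound _ zero_le_one fun q => ?_
    rw [one_mul]
    show ‖(((q.1.1, (0 : ℝ)) : ℝ × ℝ), q.2)‖ ≤ ‖q‖
    simp only [Prod.norm_def, norm_zero]
    exact max_le (max_le (le_trans (le_max_left _ _) (le_max_left _ _)) (le_trans (norm_nonneg q.1.1)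
      (le_trans (le_max_left _ _) (le_max_left _ _)))) (le_max_right _ _)

end Classes

/-! ## The Duhamel solution inherits the weighted space-time bounds -/

section Assembly

/-- **Qualitative space-time regularity of the Duhamel formula.** If the absorption `Λ` and the
source `Γ` are smooth with all derivatives bounded, with polynomial weights in `(x, v)`, on
every time slab `|t| ≤ T'`, and the datum `f₀` is of Schwartz type, then the Duhamel solution
`U` has the same property. (Write `U(p) = Ũ((0,0), p)` where `Ũ` is built from `Λ ∘ Ψ`,
`Γ ∘ Ψ`, `f₀ ∘ Ψ` by products, `e^{-(·)}`, multiplication by `t`, `θ'`, affine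
reparametrisations and `∫₀¹ dθ` — the substitutions `σ = tθ'θ`, `s = tθ'` in the time
integrals — and use the closure properties of the weighted class.) [folklore] -/
theorem duhamel_decST [FiniteDimensional ℝ E] {Λ Γ : ℝ × E × E → ℝ} {f₀ : E × E → ℝ} {U : ℝ × E × E → ℝ}
    (hf₀ : ContDiff ℝ ∞ f₀) (hΛ : ContDiff ℝ ∞ Λ) (hΓ : ContDiff ℝ ∞ Γ)
    (hU : ∀ t x v, U (t, x, v) =
      f₀ (x - t • v, v) * Real.exp (-(∫ σ in (0 : ℝ)..t, Λ (σ, x - (t - σ) • v, v))) +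
        ∫ s in (0 : ℝ)..t, Real.exp (-(∫ σ in s..t, Λ (σ, x - (t - σ) • v, v))) * Γ (s, x - (t - s) • v, v))
    (dΛ : ∀ (n k : ℕ) (T' : ℝ), ∃ C : ℝ, ∀ p : ℝ × E × E, |p.1| ≤ T' →
      (1 + ‖p.2‖) ^ k * ‖iteratedFDeriv ℝ n Λ p‖ ≤ C)
    (dΓ : ∀ (n k : ℕ) (T' : ℝ), ∃ C : ℝ, ∀ p : ℝ × E × E, |p.1| ≤ T' →
      (1 + ‖p.2‖) ^ k * ‖iteratedFDeriv ℝ n Γ p‖ ≤ C)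
    (df₀ : ∀ n k : ℕ, ∃ C : ℝ, ∀ z : E × E, (1 + ‖z‖) ^ k * ‖iteratedFDeriv ℝ n f₀ z‖ ≤ C) :
    ∀ (n k : ℕ) (T' : ℝ), ∃ C : ℝ, ∀ p : ℝ × E × E, |p.1| ≤ T' →
      (1 + ‖p.2‖) ^ k * ‖iteratedFDeriv ℝ n U p‖ ≤ C := by
  -- the substitution map
  set Ψ : (ℝ × ℝ) × (ℝ × E × E) → ℝ × E × E := fun q =>
    (q.2.1 * q.1.2 * q.1.1, q.2.2.1 - (q.2.1 - q.2.1 * q.1.2 * q.1.1) • q.2.2.2, q.2.2.2) with hΨ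
  have hΨs : ContDiff ℝ ∞ Ψ := by
    have ha : ContDiff ℝ ∞ fun q : (ℝ × ℝ) × (ℝ × E × E) => q.2.1 * q.1.2 * q.1.1 :=
      ((contDiff_fst.comp contDiff_snd).mul (contDiff_snd.comp contDiff_fst)).mul (contDiff_fst.comp contDiff_fst)
    exact ha.prodMk (((contDiff_fst.comp (contDiff_snd.comp contDiff_snd)).sub
      (((contDiff_fst.comp contDiff_snd).sub ha).smul (contDiff_snd.comp (contDiff_snd.comp contDiff_snd)))).prodMk
      (contDiff_snd.comp (contDiff_snd.comp contDiff_snd)))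
  -- parameter maps
  obtain ⟨⟨Lsw, hLsw, nLsw⟩, ⟨L10, hL10, nL10⟩, ⟨Linr, hLinr, nLinr⟩⟩ := exists_paramCLMs (E := E)
  obtain ⟨Lsl, hLsl, nLsl⟩ := exists_sliceCLM (E := E)
  obtain ⟨bt, btθ⟩ := bdd2_coords (E := E)
  have hts : ContDiff ℝ ∞ fun q : (ℝ × ℝ) × (ℝ × E × E) => q.2.1 := contDiff_fst.comp contDiff_snd
  have htθs : ContDiff ℝ ∞ fun q : (ℝ × ℝ) × (ℝ × E × E) => q.2.1 * q.1.2 := hts.mul (contDiff_snd.comp contDiff_fst)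
  -- (1) compositions with `Ψ`
  set ΛΨ : (ℝ × ℝ) × (ℝ × E × E) → ℝ := fun q => Λ (Ψ q) with hΛΨ
  have hΛΨs : ContDiff ℝ ∞ ΛΨ := hΛ.comp hΨs
  have dΛΨ : ∀ (n k : ℕ) (T' : ℝ), ∃ C : ℝ, ∀ q : (ℝ × ℝ) × (ℝ × E × E), q.1 ∈ Icc (0 : ℝ) 1 ×ˢ Icc (0 : ℝ) 1 →
      |q.2.1| ≤ T' → (1 + ‖q.2.2‖) ^ k * ‖iteratedFDeriv ℝ n ΛΨ q‖ ≤ C := dec2_comp_psi hΛ dΛ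
  set ΓΨ : (ℝ × ℝ) × (ℝ × E × E) → ℝ := fun q => Γ (Ψ q) with hΓΨ
  have hΓΨs : ContDiff ℝ ∞ ΓΨ := hΓ.comp hΨs
  have dΓΨ : ∀ (n k : ℕ) (T' : ℝ), ∃ C : ℝ, ∀ q : (ℝ × ℝ) × (ℝ × E × E), q.1 ∈ Icc (0 : ℝ) 1 ×ˢ Icc (0 : ℝ) 1 →
      |q.2.1| ≤ T' → (1 + ‖q.2.2‖) ^ k * ‖iteratedFDeriv ℝ n ΓΨ q‖ ≤ C := dec2_comp_psi hΓ dΓ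
  set FΨ : (ℝ × ℝ) × (ℝ × E × E) → ℝ := fun q => f₀ (Ψ q).2 with hFΨ
  have hFΨs : ContDiff ℝ ∞ FΨ := (hf₀.comp contDiff_snd).comp hΨs
  have dFΨ : ∀ (n k : ℕ) (T' : ℝ), ∃ C : ℝ, ∀ q : (ℝ × ℝ) × (ℝ × E × E), q.1 ∈ Icc (0 : ℝ) 1 ×ˢ Icc (0 : ℝ) 1 →
      |q.2.1| ≤ T' → (1 + ‖q.2.2‖) ^ k * ‖iteratedFDeriv ℝ n FΨ q‖ ≤ C :=
    dec2_comp_psi (G := fun p : ℝ × E × E => f₀ p.2) (hf₀.comp contDiff_snd) (decST_of_data hf₀ df₀)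
  -- (2) `I₁(θ', p) = ∫₀¹ Λ(Ψ((θ, θ'), p)) dθ`, `Aw = t θ' I₁` (`= ∫₀^{tθ'} Λ♯`)
  set I₁ : (ℝ × ℝ) × (ℝ × E × E) → ℝ := fun q => ∫ θ in (0 : ℝ)..1, ΛΨ ((θ, q.1.2), q.2) with hI₁
  obtain ⟨hI₁s, dI₁⟩ := dec2_intervalIntegral hΛΨs dΛΨ
  set Aw : (ℝ × ℝ) × (ℝ × E × E) → ℝ := fun q => (q.2.1 * q.1.2) * I₁ q with hAw
  have hAws : ContDiff ℝ ∞ Aw := htθs.mul hI₁s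
  have dAw := dec2_mul htθs hI₁s btθ dI₁
  -- (3) `Afun = Aw ∘ (θ' := 1)` (`= ∫₀ᵗ Λ♯`)
  set c₁ : (ℝ × ℝ) × (ℝ × E × E) := (((0 : ℝ), (1 : ℝ)), (0 : ℝ × E × E)) with hc₁
  have hc₁L : ∀ q : (ℝ × ℝ) × (ℝ × E × E), c₁ + L10 q = ((q.1.1, (1 : ℝ)), q.2) := fun q => by
    rw [hL10, hc₁]; simp
  set Afun : (ℝ × ℝ) × (ℝ × E × E) → ℝ := fun q => Aw (c₁ + L10 q) with hAfun
  have hAfuns : ContDiff ℝ ∞ Afun := hAws.comp (contDiff_const.add L10.contDiff)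
  have dAfun := dec2_comp_affine hAws dAw c₁ L10 nL10 (fun q => by rw [hc₁L])
    (fun q hq => by rw [hc₁L]; exact ⟨hq.1, ⟨zero_le_one, le_rfl⟩⟩)
  -- (4) the exponential factors
  set Dfun : (ℝ × ℝ) × (ℝ × E × E) → ℝ := fun q => Afun q - Aw q with hDfun
  have hDfuns : ContDiff ℝ ∞ Dfun := hAfuns.sub hAws
  have dDfun := dec2_sub hAfuns hAws dAfun dAw
  have hφs : ContDiff ℝ ∞ fun y : ℝ => Real.exp (-y) := Real.contDiff_exp.comp contDiff_neg
  set Efun : (ℝ × ℝ) × (ℝ × E × E) → ℝ := fun q => Real.exp (-(Dfun q)) with hEfun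
  have hEfuns : ContDiff ℝ ∞ Efun := hφs.comp hDfuns
  have bEfun := bdd2_comp_scalar hφs hDfuns (bdd2_of_dec2 dDfun)
  set E₀ : (ℝ × ℝ) × (ℝ × E × E) → ℝ := fun q => Real.exp (-(Afun q)) with hE₀
  have hE₀s : ContDiff ℝ ∞ E₀ := hφs.comp hAfuns
  have bE₀ := bdd2_comp_scalar hφs hAfuns (bdd2_of_dec2 dAfun)
  -- (5) the source at `θ = 1`: `ΓΨ1(θ', p) = Γ(Ψ((1, θ'), p))`
  set c₂ : (ℝ × ℝ) × (ℝ × E × E) := (((1 : ℝ), (0 : ℝ)), (0 : ℝ × E × E)) with hc₂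
  have hc₂L : ∀ q : (ℝ × ℝ) × (ℝ × E × E), c₂ + Lsl q = (((1 : ℝ), q.1.2), q.2) := fun q => by
    rw [hLsl, hc₂]; simp
  set ΓΨ1 : (ℝ × ℝ) × (ℝ × E × E) → ℝ := fun q => ΓΨ (c₂ + Lsl q) with hΓΨ1
  have hΓΨ1s : ContDiff ℝ ∞ ΓΨ1 := hΓΨs.comp (contDiff_const.add Lsl.contDiff)
  have dΓΨ1 := dec2_comp_affine hΓΨs dΓΨ c₂ Lsl nLsl (fun q => by rw [hc₂L])
    (fun q hq => by rw [hc₂L]; exact ⟨⟨zero_le_one, le_rfl⟩, hq.2⟩)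
  -- (6) the Duhamel integrand `Kf(θ', p)`, swapped, integrated: `T2 = t ∫₀¹ Kf(θ', p) dθ'`
  set Kf : (ℝ × ℝ) × (ℝ × E × E) → ℝ := fun q => Efun q * ΓΨ1 q with hKf
  have hKfs : ContDiff ℝ ∞ Kf := hEfuns.mul hΓΨ1s
  have dKf := dec2_mul hEfuns hΓΨ1s bEfun dΓΨ1
  have h0L : ∀ q : (ℝ × ℝ) × (ℝ × E × E), (0 : (ℝ × ℝ) × (ℝ × E × E)) + Lsw q = ((q.1.2, q.1.1), q.2) := fun q => by
    rw [hLsw, zero_add]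
  set Ksw : (ℝ × ℝ) × (ℝ × E × E) → ℝ := fun q => Kf (0 + Lsw q) with hKsw
  have hKsws : ContDiff ℝ ∞ Ksw := hKfs.comp (contDiff_const.add Lsw.contDiff)
  have dKsw := dec2_comp_affine hKfs dKf 0 Lsw nLsw (fun q => by rw [h0L]) (fun q hq => by rw [h0L]; exact ⟨hq.2, hq.1⟩)
  set I₂ : (ℝ × ℝ) × (ℝ × E × E) → ℝ := fun q => ∫ θ in (0 : ℝ)..1, Ksw ((θ, q.1.2), q.2) with hI₂
  obtain ⟨hI₂s, dI₂⟩ := dec2_intervalIntegral hKsws dKsw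
  set T2 : (ℝ × ℝ) × (ℝ × E × E) → ℝ := fun q => q.2.1 * I₂ q with hT2
  have hT2s : ContDiff ℝ ∞ T2 := hts.mul hI₂s
  have dT2 := dec2_mul hts hI₂s bt dI₂
  -- (7) the free term `T1 = e^{-A} f₀(x - tv, v)`
  have h0Lsl : ∀ q : (ℝ × ℝ) × (ℝ × E × E), (0 : (ℝ × ℝ) × (ℝ × E × E)) + Lsl q = (((0 : ℝ), q.1.2), q.2) := fun q => by
    rw [hLsl, zero_add]
  set F₀S : (ℝ × ℝ) × (ℝ × E × E) → ℝ := fun q => FΨ (0 + Lsl q) with hF₀S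
  have hF₀Ss : ContDiff ℝ ∞ F₀S := hFΨs.comp (contDiff_const.add Lsl.contDiff)
  have dF₀S := dec2_comp_affine hFΨs dFΨ 0 Lsl nLsl (fun q => by rw [h0Lsl])
    (fun q hq => by rw [h0Lsl]; exact ⟨⟨le_rfl, zero_le_one⟩, hq.2⟩)
  set T1 : (ℝ × ℝ) × (ℝ × E × E) → ℝ := fun q => E₀ q * F₀S q with hT1
  have hT1s : ContDiff ℝ ∞ T1 := hE₀s.mul hF₀Ss
  have dT1 := dec2_mul hE₀s hF₀Ss bE₀ dF₀S
  -- (8) `Ũ = T1 + T2`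
  set Ut : (ℝ × ℝ) × (ℝ × E × E) → ℝ := fun q => T1 q + T2 q with hUt
  have hUts : ContDiff ℝ ∞ Ut := hT1s.add hT2s
  have dUt := dec2_add hT1s hT2s dT1 dT2
  -- (9) the identity `U p = Ũ((0,0), p)`
  have hident : ∀ p : ℝ × E × E, U p = Ut (0 + Linr p) := by
    intro p
    obtain ⟨t, x, v⟩ := p
    have hq : (0 : (ℝ × ℝ) × (ℝ × E × E)) + Linr (t, x, v) = (((0 : ℝ), (0 : ℝ)), (t, x, v)) := by rw [hLinr, zero_add]
    rw [hq]
    -- normalise the right-hand side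
    simp only [hUt, hT1, hT2, hE₀, hF₀S, hFΨ, hI₂, hKsw, hKf, hEfun, hDfun, hAfun, hAw, hI₁, hΛΨ, hΓΨ1, hΓΨ, hΨ,
      h0L, h0Lsl, hc₁L, hc₂L, mul_one, mul_zero, sub_zero]
    -- transform the left-hand side: substitutions in the time integrals
    have hc : ∀ s : ℝ, Continuous fun σ : ℝ => Λ (σ, x - (t - σ) • v, v) := fun _ =>
      hΛ.continuous.comp (continuous_id.prodMk ((continuous_const.sub
        ((continuous_const.sub continuous_id).smul continuous_const)).prodMk continuous_const))
    have hsubΛ : ∀ r : ℝ, ∫ σ in (0 : ℝ)..r, Λ (σ, x - (t - σ) • v, v) =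
        r * ∫ θ in (0 : ℝ)..1, Λ (r * θ, x - (t - r * θ) • v, v) := by
      intro r
      have h := intervalIntegral.smul_integral_comp_mul_left (fun σ => Λ (σ, x - (t - σ) • v, v)) r (a := 0) (b := 1)
      simp only [mul_zero, mul_one, smul_eq_mul] at h
      exact h.symm
    have hsplit : ∀ s : ℝ, ∫ σ in s..t, Λ (σ, x - (t - σ) • v, v) =
        (∫ σ in (0 : ℝ)..t, Λ (σ, x - (t - σ) • v, v)) - ∫ σ in (0 : ℝ)..s, Λ (σ, x - (t - σ) • v, v) := by
      intro s
      rw [intervalIntegral.integral_interval_sub_left ((hc s).intervalIntegrable _ _) ((hc s).intervalIntegrable _ _)]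
    have hsubK : ∫ s in (0 : ℝ)..t, Real.exp (-(∫ σ in s..t, Λ (σ, x - (t - σ) • v, v))) * Γ (s, x - (t - s) • v, v) =
        t * ∫ θ in (0 : ℝ)..1, Real.exp (-(∫ σ in (t * θ)..t, Λ (σ, x - (t - σ) • v, v))) *
          Γ (t * θ, x - (t - t * θ) • v, v) := by
      have h := intervalIntegral.smul_integral_comp_mul_left
        (fun s => Real.exp (-(∫ σ in s..t, Λ (σ, x - (t - σ) • v, v))) * Γ (s, x - (t - s) • v, v)) t (a := 0) (b := 1)
      simp only [mul_zero, mul_one, smul_eq_mul] at h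
      exact h.symm
    have hsplit' : ∀ θ : ℝ, ∫ σ in (t * θ)..t, Λ (σ, x - (t - σ) • v, v) =
        t * (∫ θ in (0 : ℝ)..1, Λ (t * θ, x - (t - t * θ) • v, v)) -
          t * θ * ∫ θ_1 in (0 : ℝ)..1, Λ (t * θ * θ_1, x - (t - t * θ * θ_1) • v, v) := by
      intro θ
      rw [hsplit, hsubΛ t, hsubΛ (t * θ)]
    rw [hU, hsubK, hsubΛ t]
    simp_rw [hsplit']
    ring
  -- (10) conclusion
  intro n k T'
  obtain ⟨C, hC⟩ := dUt n k T'
  refine ⟨C, fun p hp => ?_⟩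
  have hUeq : U = fun p => Ut (0 + Linr p) := funext hident
  rw [hUeq]
  have h1 := norm_iteratedFDeriv_comp_affine_le hUts 0 Linr nLinr n p
  have hq : (0 : (ℝ × ℝ) × (ℝ × E × E)) + Linr p = (((0 : ℝ), (0 : ℝ)), p) := by rw [hLinr, zero_add]
  have h2 := hC (0 + Linr p) (by rw [hq]; exact ⟨⟨le_rfl, zero_le_one⟩, ⟨le_rfl, zero_le_one⟩⟩) (by rw [hq]; exact hp)
  rw [hq] at h1 h2
  exact (mul_le_mul_of_nonneg_left h1 (by positivity)).trans h2

end Assembly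

end Literature.MathematicalPhysics.KineticTheory

end
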